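import Summits.QuantumFields.BalabanUV.Beta.GAN24.ChargeTowerClimb

/-!
# `BalabanUV.Beta.GAN24.ChargeTowerRegauge` — binder row G-an2-4 ∕ (CONV-C), the (S) row ∕ (W-γ) AT EVERY LEVEL («the Δ_j-exact charge tower», road-P2 gen 41, memo
# `HOME/b2b-balaban-gan24-p2/gen41/W-GAMMA-TOWER-v0.md` §7 (2)): **RE-GAUGING THE CLIMBED POTENTIAL** — the value-Hessian image `Δ_{j+1}` is BLIND TO GRADIENTS OF BOUNDED FUNCTIONS,
# so the climbed potential `m′` of `ChargeTowerClimb` §3 may be replaced by its hard-axial representative `Π^ρ m′ = m′ − d λ^ρ_{m′}` (leaf-06 ∕ an5's rooted projector: bounded,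
# ZERO ON THE COMB BONDS) without changing the `Δ`-image — the next rung's hypotheses `hmB` ∕ `hm0` are met and the ladder iterates

NOT IN PRINT; OUR BOOKKEEPING ([folklore] by name: an2's second-slot co-closedness of the multiplier response `ValueHessianBlind.codiff₁_wΦ_right` summed by parts against a bounded
function, the rooted projector `RootedComb.axProjAt` (`axProjAt_apply`; leaf-02 g51's `CoDressedColumnPairing.abs_treeGaugeAt_le`; leaf-06 g46's `abs_axProjAt_le`; an5's
`axProjAt_eq_zero_of_isCombBond`), the Literature bound `ResolventCompositionStepB.abs_contourSum_le`, and `ChargeTowerClimb` §3; 0 `def`, 0 cited fact, 0 `def … : Prop`, 0 sorry).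
HONEST FRAMING (cell contract, verbatim): «discharging `BetaPertH` makes Bałaban's UV stability UNCONDITIONAL — a real constructive-QFT result; it is NOT the continuum limit and NOT the
Clay problem.»  HONEST DEPENDENCY (verbatim): «continuum YM on T⁴ ⇐ BetaPertH ∧ nine spine estimates (0/9 proved); BetaPertH ⇐ (D1) ∧ (D4) ∧ CAP+tail; G-an2-4 gates asym, D1 and NE2/3/4.»

* §1 **`tsum_sum_wΦ_mul_dz_eq_zero`**: for every blocking `M` and every BOUNDED `λ`, `Σ'_v Σ_l wΦ_M κ l (u − v)·(dλ) l v = 0` (shift `v ↦ v − e_l` ⨾ `codiff₁_wΦ_right`).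
* §2 **`tsum_sum_wΦ_mul_axProjAt_eq`**: for bounded `m`, `Σ'_v Σ_l wΦ_M κ l (u − v)·(Π^ρ m) l v = Σ'_v Σ_l wΦ_M κ l (u − v)·m l v` (in-block root `ρ = toSite r`, `Π^ρ m = m − d λ^ρ_m`, `λ^ρ_m` bounded).
* §3 `abs_smul_contourSum_le` (the climbed potential `(σ∕wVH)·𝒬_{Lc} m` is bounded), **`tsum_sum_E2image_mul_colH_climbs_regauged`** (every `j`, `m` bounded and zero on the comb bonds):
  `Σ'_u Σ_κ (Δ_{j+1} m)(κ,u)·colH G_{j+1} Lc ν y′ κ u = wVH_{j+2}·Σ'_y Σ_κ wΦ_{Lc^{j+2}} ν κ (y′ − y)·(Π^ρ m′) κ y`, `m′ = (σ_{j+1}∕wVH_{j+2})·𝒬_{Lc} m` — `ChargeTowerClimb` §3 with the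
  climbed potential replaced by its HARD-AXIAL REPRESENTATIVE, which is bounded (`abs_axProjAt_le`) and ZERO ON THE COMB BONDS (`axProjAt_eq_zero_of_isCombBond`): exactly the hypotheses
  `hmB`, `hm0` of the next rung (`ChargeTowerClimb` §3∕§5–§8 at `j + 1`).  The ladder iterates.
* §4 THE PERIODICITY LEDGER of the class bookkeeping (memo §8): **`contourSum_add_zsmul_of_periodic_mul`** (`𝒬_{Lc}` of an `(Lc·P)`-PERIODIC form is `P`-PERIODIC on the coarse lattice),
  `treeGaugeAt_add_zsmul_of_periodic_mul` and **`axProjAt_add_zsmul_of_periodic_mul`** (the tree gauge and the hard-axial representative of an `(Lc·P)`-periodic form are `(Lc·P)`-periodic): the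
  exit class of level `n` pulls back to `exit^{Lc^{n+1}}` at level 0 and its potential climbs through `Lc^{n+1−k}`-periodic representatives to an `Lc`-periodic one at level `n`, where (M1)_n
  (`ChargeTowerClimb` §8) applies.
Asserts NO value of Bałaban's tables; discharges NOTHING of (W-γ)'s exit sub-row ∕ (INV) ∕ (S) ∕ (Q-R) ∕ (LT) ∕ (Q-L) ∕ (C) ∕ «T2Shape» ∕ «T2Drift» ∕ (hW, hWall); NEVER «G-an2-4 closed» as
(CONV-C); NOT D1, NOT `BetaPertH`, NOT continuum, NOT Clay.  2026-08-22; no existing file touched.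
-/

noncomputable section

open Finset
open scoped BigOperators
open Literature.MathematicalPhysics.QuantumFieldTheory
open Literature.MathematicalPhysics.QuantumFieldTheory.Balaban1983to89
open Literature.MathematicalPhysics.QuantumFieldTheory.Balaban1983to89.Beta
open ExpKernelCalculus (Site MKer)
open AffineAveraging (Form0 Form1 box toSite unitVec dz contourSum codiff₁)
open AveragingContours (shift)
open AveragingContoursRooted (treeGaugeAt)
open RootedComb (axProjAt axProjAt_apply)
open KernelSpecInstance (wΦ)
open OneStepResolventKernel (Fib)
open OneStepKernelFamily (KInvStep colH)
open BalabanStepJetsSucc (wVH)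
open ResolventCompositionStepB (abs_contourSum_le)
open Summit.QuantumFields.BalabanUV.Beta.AxialDressingRooted (IsCombBondAt coDressKBmAt one_le_of_neZero axProjAt_eq_zero_of_isCombBond treeGaugeAt_shift)
open Summit.QuantumFields.BalabanUV.Beta.BorderedHessian (stepScale codiff₁_wΦ_right)
open Summit.QuantumFields.BalabanUV.Beta.GAN24.MultiplierZeroMass (summable_wΦ)
open Summit.QuantumFields.BalabanUV.Beta.GAN24.CoarseGaugeSourceResponse (summable_bdd_mul tsum_add_shift)
open Summit.QuantumFields.BalabanUV.Beta.GAN24.CoDressedColumnPairing (abs_treeGaugeAt_le)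
open Summit.QuantumFields.BalabanUV.Beta.GAN24.EdgePotentialColumnOrthogonal (abs_axProjAt_le)
open Summit.QuantumFields.BalabanUV.Beta.GAN24.ChargeTowerClimb (tsum_sum_E2image_mul_colH_climbs)

namespace Summit.QuantumFields.BalabanUV.Beta.GAN24.ChargeTowerRegauge

variable {d : ℕ} {Lc : ℕ} [NeZero Lc] {r : Fin (d + 1) → ℕ}

/-! ## §1 The value-Hessian image is blind to gradients of bounded functions -/

omit [NeZero Lc] in
/-- [folklore] A bounded function against a shifted row of `wΦ` is summable. -/
theorem summable_wΦ_shift_mul (M : ℕ) [NeZero M] {g : Site (d + 1) → ℝ} {B : ℝ} (hg : ∀ v, |g v| ≤ B) (κ l : Fin (d + 1)) (u c : Site (d + 1)) :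
    Summable fun v : Site (d + 1) => wΦ (N := M) κ l (u - (v - c)) * g v := by
  have hs : Summable fun v : Site (d + 1) => wΦ (N := M) κ l (u - (v - c)) := by
    have h := (summable_wΦ (N := M) κ l).comp_injective
      (show Function.Injective (fun v : Site (d + 1) => u - (v - c)) from fun a b hab => by simpa using hab)
    simpa only [Function.comp_def] using h
  have h2 := summable_bdd_mul hs hg
  exact h2.congr fun v => mul_comm _ _

omit [NeZero Lc] in
/-- NOT IN PRINT; OUR BOOKKEEPING.  **THE VALUE-HESSIAN IMAGE IS BLIND TO GRADIENTS OF BOUNDED FUNCTIONS** (every blocking `M`, every bounded `λ : Site → ℝ`):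
`Σ'_v Σ_l wΦ_M κ l (u − v)·(dλ) l v = 0` — shift the first half of `dλ l v = λ(v + e_l) − λ(v)` by `e_l` and sum an2's second-slot co-closedness
`Σ_l (wΦ_M κ l (u − (w − e_l)) − wΦ_M κ l (u − w)) = 0` (`ValueHessianBlind.codiff₁_wΦ_right`) against `λ(w)`. -/
theorem tsum_sum_wΦ_mul_dz_eq_zero (M : ℕ) [NeZero M] {lam : Form0 (d + 1) ℝ} {B : ℝ} (hlam : ∀ v, |lam v| ≤ B) (κ : Fin (d + 1)) (u : Site (d + 1)) :
    ∑' v, ∑ l : Fin (d + 1), wΦ (N := M) κ l (u - v) * dz lam l v = 0 := by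
  classical
  -- summability of the two halves, per direction
  have hA : ∀ l, Summable fun v : Site (d + 1) => wΦ (N := M) κ l (u - v) * lam (v + unitVec l) := fun l => by
    have h := summable_wΦ_shift_mul M (g := fun v => lam (v + unitVec l)) (fun v => hlam _) κ l u 0
    simpa only [sub_zero] using h
  have hB : ∀ l, Summable fun v : Site (d + 1) => wΦ (N := M) κ l (u - v) * lam v := fun l => by
    have h := summable_wΦ_shift_mul M hlam κ l u 0
    simpa only [sub_zero] using h
  have hsplit : ∀ v, ∑ l : Fin (d + 1), wΦ (N := M) κ l (u - v) * dz lam l v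
      = ∑ l : Fin (d + 1), (wΦ (N := M) κ l (u - v) * lam (v + unitVec l) - wΦ (N := M) κ l (u - v) * lam v) :=
    fun v => Finset.sum_congr rfl fun l _ => by simp only [dz]; ring
  rw [tsum_congr hsplit, Summable.tsum_finsetSum (fun l _ => (hA l).sub (hB l))]
  -- shift the first half: `Σ'_v wΦ(u − v)·λ(v + e_l) = Σ'_w wΦ(u − (w − e_l))·λ(w)`
  have hshift : ∀ l, ∑' v, wΦ (N := M) κ l (u - v) * lam (v + unitVec l) = ∑' w, wΦ (N := M) κ l (u - (w - unitVec l)) * lam w := by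
    intro l
    rw [← tsum_add_shift (fun w => wΦ (N := M) κ l (u - (w - unitVec l)) * lam w) (unitVec l)]
    refine tsum_congr fun v => ?_
    simp only [add_sub_cancel_right]
  have hC : ∀ l, Summable fun w : Site (d + 1) => wΦ (N := M) κ l (u - (w - unitVec l)) * lam w := fun l =>
    summable_wΦ_shift_mul M hlam κ l u (unitVec l)
  have e3 : ∀ l, ∑' v, (wΦ (N := M) κ l (u - v) * lam (v + unitVec l) - wΦ (N := M) κ l (u - v) * lam v)
      = ∑' w, (wΦ (N := M) κ l (u - (w - unitVec l)) * lam w - wΦ (N := M) κ l (u - w) * lam w) := by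
    intro l
    rw [(hA l).tsum_sub (hB l), hshift l, ← (hC l).tsum_sub (hB l)]
  rw [Finset.sum_congr rfl (fun l _ => e3 l), ← Summable.tsum_finsetSum (fun l _ => (hC l).sub (hB l))]
  have hpt : ∀ w, ∑ l : Fin (d + 1), (wΦ (N := M) κ l (u - (w - unitVec l)) * lam w - wΦ (N := M) κ l (u - w) * lam w) = 0 := by
    intro w
    have h := congr_fun (codiff₁_wΦ_right (N := M) (d := d) κ u) w
    simp only [codiff₁, Pi.zero_apply] at h
    rw [show (∑ l : Fin (d + 1), (wΦ (N := M) κ l (u - (w - unitVec l)) * lam w - wΦ (N := M) κ l (u - w) * lam w))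
        = (∑ l : Fin (d + 1), (wΦ (N := M) κ l (u - (w - unitVec l)) - wΦ (N := M) κ l (u - w))) * lam w from by
      rw [Finset.sum_mul]; exact Finset.sum_congr rfl fun l _ => by ring]
    rw [h, zero_mul]
  simp only [hpt, tsum_zero]

/-! ## §2 The image of the hard-axial representative -/

/-- NOT IN PRINT; OUR BOOKKEEPING.  **THE VALUE-HESSIAN IMAGE OF THE HARD-AXIAL REPRESENTATIVE EQUALS THAT OF THE FORM** (in-block root `ρ = toSite r`, every blocking `M`, bounded `m`):
`Σ'_v Σ_l wΦ_M κ l (u − v)·(Π^ρ m) l v = Σ'_v Σ_l wΦ_M κ l (u − v)·m l v` — `Π^ρ m = m − d λ^ρ_m` (`axProjAt_apply`) with `λ^ρ_m` bounded (`abs_treeGaugeAt_le`), §1. -/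
theorem tsum_sum_wΦ_mul_axProjAt_eq (M : ℕ) [NeZero M] (hr : r ∈ box (d + 1) Lc) {m : Form1 (d + 1) ℝ} {B : ℝ} (hmB : ∀ κ u, |m κ u| ≤ B)
    (κ : Fin (d + 1)) (u : Site (d + 1)) :
    ∑' v, ∑ l : Fin (d + 1), wΦ (N := M) κ l (u - v) * axProjAt (toSite r) Lc m l v
      = ∑' v, ∑ l : Fin (d + 1), wΦ (N := M) κ l (u - v) * m l v := by
  classical
  have hLc : 1 ≤ Lc := one_le_of_neZero Lc
  have hlam : ∀ v, |treeGaugeAt (toSite r) m Lc v| ≤ (((d + 1 : ℕ) : ℝ)) * Lc * B := fun v => abs_treeGaugeAt_le hLc hr hmB v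
  have hpt : ∀ v, ∑ l : Fin (d + 1), wΦ (N := M) κ l (u - v) * axProjAt (toSite r) Lc m l v
      = (∑ l : Fin (d + 1), wΦ (N := M) κ l (u - v) * m l v) - ∑ l : Fin (d + 1), wΦ (N := M) κ l (u - v) * dz (treeGaugeAt (toSite r) m Lc) l v := by
    intro v
    rw [← Finset.sum_sub_distrib]
    refine Finset.sum_congr rfl fun l _ => ?_
    rw [axProjAt_apply]
    simp only [dz]
    ring
  have hs1 : Summable fun v => ∑ l : Fin (d + 1), wΦ (N := M) κ l (u - v) * m l v :=
    summable_sum fun l _ => by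
      have h := summable_wΦ_shift_mul M (hmB l) κ l u 0
      simpa only [sub_zero] using h
  have hs2 : Summable fun v => ∑ l : Fin (d + 1), wΦ (N := M) κ l (u - v) * dz (treeGaugeAt (toSite r) m Lc) l v :=
    summable_sum fun l _ => by
      have hdz : ∀ v, |dz (treeGaugeAt (toSite r) m Lc) l v| ≤ (((d + 1 : ℕ) : ℝ)) * Lc * B + (((d + 1 : ℕ) : ℝ)) * Lc * B := fun v => by
        simp only [dz]
        have h1 := hlam (v + unitVec l)
        have h2 := hlam v
        have t := abs_sub (treeGaugeAt (toSite r) m Lc (v + unitVec l)) (treeGaugeAt (toSite r) m Lc v)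
        linarith
      have h := summable_wΦ_shift_mul M hdz κ l u 0
      simpa only [sub_zero] using h
  rw [tsum_congr hpt, hs1.tsum_sub hs2, tsum_sum_wΦ_mul_dz_eq_zero M hlam κ u, sub_zero]

/-! ## §3 The re-gauged climb: the next rung's hypotheses are met -/

omit [NeZero Lc] in
/-- [folklore] The climbed potential is bounded: `|(a·𝒬_{L} m) κ y| ≤ |a|·#box·(L·B)`. -/
theorem abs_smul_contourSum_le (L : ℕ) {m : Form1 (d + 1) ℝ} {B : ℝ} (hmB : ∀ κ u, |m κ u| ≤ B) (a : ℝ) (κ : Fin (d + 1)) (y : Site (d + 1)) :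
    |a * contourSum L m κ y| ≤ |a| * ((box (d + 1) L).card * (L * B)) := by
  rw [abs_mul]
  exact mul_le_mul_of_nonneg_left (abs_contourSum_le hmB κ y) (abs_nonneg _)

/-- NOT IN PRINT; OUR BOOKKEEPING.  **THE RE-GAUGED CLIMB** (every `j`, in-block root, `m` bounded and zero on the comb bonds): with the climbed potential `m′ := (σ_{j+1}∕wVH_{j+2})·𝒬_{Lc} m`
and its HARD-AXIAL REPRESENTATIVE `Π^ρ m′` (`ρ = toSite r`),
`Σ'_u Σ_κ (wVH_{j+1}·Σ'_v Σ_l wΦ_{Lc^{j+1}} κ l (u − v)·m l v)·colH G_{j+1} Lc ν y′ κ u = wVH_{j+2}·Σ'_y Σ_κ wΦ_{Lc^{j+2}} ν κ (y′ − y)·(Π^ρ m′) κ y`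
(`ChargeTowerClimb.tsum_sum_E2image_mul_colH_climbs` ⨾ §2).  `Π^ρ m′` is BOUNDED (`EdgePotentialColumnOrthogonal.abs_axProjAt_le` with `abs_smul_contourSum_le`) and ZERO ON THE COMB BONDS
(`axProjAt_eq_zero_of_isCombBond`) — the hypotheses `hmB`, `hm0` of the next rung: the ladder `ChargeTowerClimb` §3∕§5–§8 iterates level by level. -/
theorem tsum_sum_E2image_mul_colH_climbs_regauged (hr : r ∈ box (d + 1) Lc) (j : ℕ) {m : Form1 (d + 1) ℝ} {B : ℝ} (hmB : ∀ κ u, |m κ u| ≤ B)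
    (hm0 : ∀ κ u, IsCombBondAt (toSite r) Lc κ u → m κ u = 0) (ν : Fin (d + 1)) (y' : Site (d + 1)) :
    ∑' u, ∑ κ, (wVH d Lc (j + 1) * ∑' v, ∑ l : Fin (d + 1), wΦ (N := Lc ^ (j + 1)) κ l (u - v) * m l v)
        * colH (coDressKBmAt (toSite r) Lc (KInvStep (d := d) Lc (j + 1))) Lc ν y' κ u
      = wVH d Lc (j + 2) * ∑' y, ∑ κ, wΦ (N := Lc ^ (j + 2)) ν κ (y' - y)
          * axProjAt (toSite r) Lc (fun l v => (stepScale d Lc (j + 1) / wVH d Lc (j + 2)) * contourSum Lc m l v) κ y := by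
  rw [tsum_sum_E2image_mul_colH_climbs hr j hmB hm0 ν y']
  congr 1
  exact (tsum_sum_wΦ_mul_axProjAt_eq (Lc ^ (j + 2)) hr (m := fun l v => (stepScale d Lc (j + 1) / wVH d Lc (j + 2)) * contourSum Lc m l v)
    (fun l v => abs_smul_contourSum_le Lc hmB _ l v) ν y').symm

/-- NOT IN PRINT; OUR BOOKKEEPING.  The two hypotheses of the next rung for the re-gauged climbed potential, by name: it is bounded and vanishes on the comb bonds. -/
theorem axProjAt_climbed_bdd_and_comb_zero (hr : r ∈ box (d + 1) Lc) (j : ℕ) {m : Form1 (d + 1) ℝ} {B : ℝ} (hmB : ∀ κ u, |m κ u| ≤ B) :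
    (∀ κ y, |axProjAt (toSite r) Lc (fun l v => (stepScale d Lc (j + 1) / wVH d Lc (j + 2)) * contourSum Lc m l v) κ y|
        ≤ |stepScale d Lc (j + 1) / wVH d Lc (j + 2)| * ((box (d + 1) Lc).card * (Lc * B))
          + 2 * ((((d + 1 : ℕ) : ℝ)) * Lc * (|stepScale d Lc (j + 1) / wVH d Lc (j + 2)| * ((box (d + 1) Lc).card * (Lc * B))))) ∧
    (∀ κ y, IsCombBondAt (toSite r) Lc κ y →
        axProjAt (toSite r) Lc (fun l v => (stepScale d Lc (j + 1) / wVH d Lc (j + 2)) * contourSum Lc m l v) κ y = 0) :=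
  ⟨fun κ y => abs_axProjAt_le (one_le_of_neZero Lc) hr (fun l v => abs_smul_contourSum_le Lc hmB _ l v) κ y,
    fun _ _ h => axProjAt_eq_zero_of_isCombBond h _⟩

/-! ## §4 The periodicity ledger: block contour sums and hard-axial representatives of `(Lc·P)`-periodic forms -/

omit [NeZero Lc] in
/-- [folklore] **`𝒬_{Lc}` OF AN `(Lc·P)`-PERIODIC FORM IS `P`-PERIODIC**: `∀ κ x v, m κ (x + (Lc·P)•v) = m κ x` ⇒ `𝒬_{Lc} m κ (y + P•v) = 𝒬_{Lc} m κ y`. -/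
theorem contourSum_add_zsmul_of_periodic_mul (P : ℕ) {m : Form1 (d + 1) ℝ} (hper : ∀ κ x v, m κ (x + ((Lc * P : ℕ) : ℤ) • v) = m κ x)
    (κ : Fin (d + 1)) (y v : Site (d + 1)) : contourSum Lc m κ (y + (P : ℤ) • v) = contourSum Lc m κ y := by
  simp only [AffineAveraging.contourSum]
  refine Finset.sum_congr rfl fun b _ => Finset.sum_congr rfl fun s _ => ?_
  have e : (Lc : ℤ) • (y + (P : ℤ) • v) + toSite b + (s : ℤ) • unitVec κ
      = ((Lc : ℤ) • y + toSite b + (s : ℤ) • unitVec κ) + ((Lc * P : ℕ) : ℤ) • v := by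
    rw [smul_add, smul_smul, Nat.cast_mul]; abel
  rw [e, hper]

/-- [folklore] **THE TREE GAUGE OF AN `(Lc·P)`-PERIODIC FORM IS `(Lc·P)`-PERIODIC** (`treeGaugeAt_shift` with the coarse translation `P•v`). -/
theorem treeGaugeAt_add_zsmul_of_periodic_mul (P : ℕ) (ρ : Fin (d + 1) → ℤ) {m : Form1 (d + 1) ℝ}
    (hper : ∀ κ x v, m κ (x + ((Lc * P : ℕ) : ℤ) • v) = m κ x) (x v : Site (d + 1)) :
    treeGaugeAt ρ m Lc (x + ((Lc * P : ℕ) : ℤ) • v) = treeGaugeAt ρ m Lc x := by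
  have hLc : 1 ≤ Lc := one_le_of_neZero Lc
  have e1 : ((Lc * P : ℕ) : ℤ) • v = (Lc : ℤ) • ((P : ℤ) • v) := by rw [smul_smul, Nat.cast_mul]
  rw [e1, treeGaugeAt_shift ρ hLc m x ((P : ℤ) • v)]
  have e : shift ((Lc : ℤ) • ((P : ℤ) • v)) m = m := by
    funext κ z
    simp only [shift]
    rw [← e1, hper]
  rw [e]

/-- NOT IN PRINT; OUR BOOKKEEPING.  **THE HARD-AXIAL REPRESENTATIVE OF AN `(Lc·P)`-PERIODIC FORM IS `(Lc·P)`-PERIODIC**: `Π^ρ m κ (x + (Lc·P)•v) = Π^ρ m κ x` (`axProjAt_apply` + the previous lemma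
at `x` and `x + e_κ`).  With `contourSum_add_zsmul_of_periodic_mul`: the re-gauged climbed potential of an `(Lc·P)`-periodic `m` is `P`-periodic… one factor of `Lc` is spent per rung. -/
theorem axProjAt_add_zsmul_of_periodic_mul (P : ℕ) (ρ : Fin (d + 1) → ℤ) {m : Form1 (d + 1) ℝ}
    (hper : ∀ κ x v, m κ (x + ((Lc * P : ℕ) : ℤ) • v) = m κ x) (κ : Fin (d + 1)) (x v : Site (d + 1)) :
    axProjAt ρ Lc m κ (x + ((Lc * P : ℕ) : ℤ) • v) = axProjAt ρ Lc m κ x := by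
  rw [axProjAt_apply, axProjAt_apply, hper, add_right_comm, treeGaugeAt_add_zsmul_of_periodic_mul P ρ hper,
    treeGaugeAt_add_zsmul_of_periodic_mul P ρ hper]

end Summit.QuantumFields.BalabanUV.Beta.GAN24.ChargeTowerRegauge

end
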